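import Mathlib
import HarnessLib
import Summits.NavierStokesRegularity.NavierStokesRegularity.Theorems.TaylorModelRungThreeCertificateFormatVGrowthFast

/-!
# Crux K1b-DR (stmt-NavierStokesRegularity-23954), line `taylor-model` — v3 certificate: tube-growth checker, VARIANT C
# (cross-chunk transfer by INTERVAL matrices; tm-g4 g5)

Variant of `…CertificateFormatVGrowth` (v1) that changes ONLY the cross-chunk transport. In v1 the start vector `ũ_a` of an
earlier chunk is carried across every intermediate chunk boundary by the emitted MAGNITUDE matrices `T̃_q` (`wVec`), so all sign
cancellation between chunks is lost (one split per boundary). Here the emitted chunk transfer is an INTERVAL matrix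
`T_q ⊇ [M_{(q+1)L−1}]⋯[M_{qL}]` (claim tested by `subsetIM` at the end of chunk `q`'s run), the transfers of the intermediate
chunks are multiplied FIRST as interval matrices (`RS`, `q − 2` extra `n³` products per chunk file, shared by all starts) and the
magnitude is taken once: `W[a'] = (|T_{q−1}⋯T_{a'/L+1}| · ũ_{a'})↑` — two splits (after `a'`'s chunk, before `b`'s chunk)
whatever the span. In-chunk work, tests, `gL1`, `ũ`, (R0)/(R1)/(R3b) are v1's VERBATIM (`GCtx.step/pairTest/facOf`, `checkL1`,
`checkR0`, `checkR1` are reused, not copied).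

* DATA (`stageV j .landAux`): `landAux[0][0] = gL1`, `landAux[1][a] = ũ_a` (as v1: `ũ_a ≥ (|[M_{C−1}]⋯[M_a]|·ω_j↑)↑`, `C` the next
  chunk boundary after `a`), and per chunk `q` with a later chunk the PAIR `landAux[2+2q] = Tlo_q`, `landAux[3+2q] = Thi_q`
  (row-major `n×n` dyadics) with `[Tlo_q, Thi_q] ⊇ [M_{(q+1)L−1}]⋯[M_{qL}]` entrywise (`gTI`).
* `RS j q m` — the interval product `T_{q−1}·T_{q−2}⋯T_{q−m}` (`m = 0`: identity); `RSarr` computes `RS j q 0, …, RS j q k` with one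
  product each; `wVecC j L q a' = (|RS j q (q − 1 − a'/L)| · ũ_{a'})↑`.
* `gctxC j L q : GCtx` — v1's context with `W[a'] := wVecC …` (and `Tq := #[]`, unused); `GCtx.claimsOKC` — the chunk-end claims
  with the interval test; `growthRunC` / `growthRangeC P j L q` — v1's run with these two changes and the FAST step `GCtx.stepF`
  of `…FormatVGrowthFast` (value-identical to `GCtx.step`); `gDC` / `GrC` — THE TABLE `G` of this variant (in-chunk pairs as
  v1, cross-chunk pairs with `wVecC`).

Definitions only; soundness in `…FormatVGrowthCSound`. Cost per chunk as v1 plus `max(q−2, 0)` interval products. MODEL-lattice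
bookkeeping only (rung TL-M3); nothing here is a statement about the Navier–Stokes equations, and nothing is asserted.
-/

-- the sub-problem namespace repeats the summit name by design (D-0017)
set_option linter.dupNamespace false

namespace Summit.NavierStokesRegularity.NavierStokesRegularity.Theorems.TaylorModelCert

open scoped BigOperators

namespace GCtx

variable (G : GCtx)

/-- **Chunk-end claims, variant C** (only if a later chunk exists, `s < S` at the chunk end `s`): the chunk product
`P(s ← qL) ⊆ T_q` entrywise (interval test) and `(|P(s ← a)|·ω↑)↑ ≤ ũ_a` for every start `a` of the chunk. [folklore] -/
def claimsOKC (TI : Array (Array IntervalD)) (s : ℕ) (pre : Array (Array (Array IntervalD))) : Bool :=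
  decide (G.S ≤ s) ||
    (subsetIM G.n (pre.getD 0 #[]) TI &&
      allN pre.size fun i => leVec G.n (absMulVecUp G.n G.prec (magM G.n (pre.getD i #[])) G.ωhi) (G.U (G.q * G.L + i)))

end GCtx

namespace CertTablesV

variable (TV : CertTablesV) (kitOf : ℕ → CoreKit) (wT : ℕ → Array Dyad)

/-! ### Emitted interval transfer matrices -/

/-- Lower ends of the emitted transfer matrix `T_q` of chunk `q` (`landAux[2+2q]`, row-major `n×n` dyadics). [folklore] -/
def gTlo (j q : ℕ) : Array (Array Dyad) := (TV.stageV j).landAux.getD (2 + 2 * q) #[]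

/-- Upper ends of the emitted transfer matrix `T_q` of chunk `q` (`landAux[3+2q]`). [folklore] -/
def gThi (j q : ℕ) : Array (Array Dyad) := (TV.stageV j).landAux.getD (3 + 2 * q) #[]

/-- **The emitted interval transfer matrix `T_q = [Tlo_q, Thi_q]`** of chunk `q` (claimed `⊇ [M_{(q+1)L−1}]⋯[M_{qL}]`). [folklore] -/
def gTI (j q : ℕ) : Array (Array IntervalD) :=
  Array.ofFn (n := TV.base.n) fun r => Array.ofFn (n := TV.base.n) fun c => ⟨dmget (TV.gTlo j q) r c, dmget (TV.gThi j q) r c⟩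

/-- **`RS j q m := T_{q−1}·T_{q−2}⋯T_{q−m}`** (interval products, bracketed from the left; `m = 0`: identity) — encloses the transfer
`P(C_q ← C_{q−m})` of the `m` chunks before chunk `q`. [folklore] -/
def RS (j q : ℕ) : ℕ → Array (Array IntervalD)
  | 0 => idIM TV.base.n
  | m + 1 => mulII TV.base.n TV.prec (RS j q m) (TV.gTI j (q - 1 - m))

/-- `RSarr j q k = #[RS j q 0, …, RS j q k]`, computed with ONE product per entry. [folklore] -/
def RSarr (j q : ℕ) : ℕ → Array (Array (Array IntervalD))
  | 0 => #[idIM TV.base.n]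
  | k + 1 =>
    let A := RSarr j q k
    A.push (mulII TV.base.n TV.prec (A.getD k #[]) (TV.gTI j (q - 1 - k)))

/-- **The transported start vector, variant C**: `(|RS j q (q − 1 − a'/L)| · ũ_{a'})↑` (for the chunk right after `a'`'s chunk the
matrix is the identity). [folklore] -/
def wVecC (j L q a' : ℕ) : Array Dyad :=
  absMulVecUp TV.base.n TV.prec (magM TV.base.n (TV.RS j q (q - 1 - a' / L))) (TV.gU j a')

/-- **The growth context of chunk `q` of stage `j`, variant C**: v1's `gctx` with the transported start vectors `W[a'] = wVecC a'`,
the magnitude matrices `|RS j q m|` computed once from `RSarr`. (`Tq` is not used by this variant.) [folklore] -/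
def gctxC (j L q : ℕ) : GCtx :=
  let mags : Array (Array (Array Dyad)) := (TV.RSarr j q (q - 1)).map (magM TV.base.n)
  { n := TV.base.n, prec := TV.prec, L := L, q := q, S := TV.S j, gL1 := TV.gL1 j, ωhi := TV.ωhiV j, ωinvhi := TV.ωinvhiV j,
    ΛdesLo := (IntervalD.ofQS2 TV.prec (TV.stageV j).Λdes).lo, ΛLo := (IntervalD.ofQS2 TV.prec (TV.base.stage j).Λ).lo,
    W := Array.ofFn (n := q * L) fun a' =>
      absMulVecUp TV.base.n TV.prec (mags.getD (q - 1 - a' / L) #[]) (TV.gU j a'),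
    U := TV.gU j, Tq := #[] }

/-! ### The table `G` of variant C -/

/-- **THE GROWTH TABLE `G_j(a,b)`, variant C** (`a ≤ b ≤ S`): in-chunk pairs as v1 (direct interval product), cross-chunk pairs by
the split at the start `C_{q_b}` of `b`'s chunk with the transported start vector `wVecC`. [folklore] -/
def gDC (j L a b : ℕ) : Dyad :=
  if b ≤ (a / L + 1) * L then (TV.gctx j L (a / L)).facOf (TV.prodM kitOf wT j a (b - a)) (TV.ωhiV j)
  else (TV.gctx j L ((b - 1) / L)).facOf (TV.prodM kitOf wT j ((b - 1) / L * L) (b - (b - 1) / L * L))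
    (TV.wVecC j L ((b - 1) / L) a)

/-- The real table `G` (variant C) handed to `ReadoutsV`. [folklore] -/
noncomputable def GrC (j L a b : ℕ) : ℝ := (TV.gDC kitOf wT j L a b).toReal

/-! ### The chunk run, variant C -/

/-- **THE CHUNK RUN, variant C**: v1's `growthRun` with the FAST step `GCtx.stepF` (= `step`), the context `G` (meant:
`gctxC j L q`) and the interval chunk claim `claimsOKC (gTI j q)` at the end. [folklore] -/
def growthRunC (P : ℕ → CoreOut → Bool) (j : ℕ) (G : GCtx) (TI : Array (Array IntervalD)) :
    ℕ → ℕ → NodeSt → Array (Array (Array IntervalD)) → Bool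
  | 0, s, _, pre => G.claimsOKC TI s pre
  | k + 1, s, N, pre =>
    let o := (TV.ctxOfW kitOf wT j).subStep s N
    let r := G.stepF s o.core.M o.core.L1 pre
    ((o.ok && P s o.core) && r.2) && growthRunC P j G TI k (s + 1) o.next r.1

/-- **GROWTH CHUNK CHECK, variant C** of chunk `q` of stage `j` (chunk length `L`): the run over `[qL, min((q+1)L, S))` from the
chunk's start state `startNode (qL)`. [folklore] -/
def growthRangeC (P : ℕ → CoreOut → Bool) (j L q : ℕ) : Bool :=
  TV.growthRunC kitOf wT P j (TV.gctxC j L q) (TV.gTI j q) (min L (TV.S j - q * L)) (q * L)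
    ((TV.ctxOfW kitOf wT j).startNode (q * L)) #[]

end CertTablesV

end Summit.NavierStokesRegularity.NavierStokesRegularity.Theorems.TaylorModelCert
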